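import Summits.ValiantsHypothesis.ValiantsHypothesis.Theorems.TwoProducts.RankTwoJacobianShiftedAxial

/-!
# Rank-two Jacobian ENGINE, shifted (part 2 of 2): cells, the SHIFT-SPECIAL set `SpecShift` and its count, the one-call template

Part 2 of FILE A (ENGINE) of the located instance T1-A′ (FERMAT TRINOMIAL `w₀^a + λ·w₁^b − κ·w₂^d`) of the OPEN rung 3-AFF of the SIDE ladder
«table-rank-ladder» of crux `stmt-ValiantsHypothesis-5906` (`TwoProducts`), priced by val-idea-crit-8 g4 VERDICT #66 / #68 (FILE A = val-port-1 g5,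
FILE B = `Theorems/TwoProducts/RankThreeAffineTrinomial.lean`); part 1 = ✓ `…RankTwoJacobianShiftedAxial` (`OnLineShift`, `IsSpecialShift`,
★★ `shiftedAxialTransfer`).
THE COUNT.  Cells of the chart `σ` are cut by `XcU σ v G = Xc σ v ∪ Eset σ G` (exceptional values of the carrier `v` and TIE values of the multiplier `G`;
outside the latter `G` has a unique top, `uniqueTop_of_not_mem_Eset`): on a cell the axial lead `e` (✓ `lead_eq_of_gap`), the unique top `g` of `G`
(`uniqueTop_eq_of_gap`, via ✓ `exists_tie_between`) AND the shifted-axis top point of `F` (`shiftPoint_eq`: two facing top points on `g + ℝ·e` differ by a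
real multiple of `e`, and `⟨dir σ ·, e⟩` keeps its sign on the cell, ✓ `sameSign`) are constant, so ✓ `utop_between` forbids a third shift-special value
per cell: `specShift_fibre_le_two`, ★ `card_SpecShift_le : |SpecShift σ v G F| ≤ 2·(|Xc σ v ∪ Eset σ G| + 1)` (additive form `card_SpecShift_le'`;
✓ `card_Xc_le`, ✓ `card_Eset_le` make it `poly(t)`) — the verbatim twin of ✓ `spec_fibre_le_two` / ✓ `card_Spec_le` (`…RankTwoJacobianTowerSpecials`).
ONE-CALL TEMPLATE for FILE B: ★ `Eset_subset_of_shifted` — if `v` is non-constant, `G ≠ 0`, `M ≠ 0` and `M·(G·J(N,v) − N·J(G,v)) = F'·Br`, then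
`Eset σ N ⊆ Xc σ v ∪ Eset σ G ∪ SpecShift σ v G N ∪ (Eset σ F' ∪ Eset σ Br)` (✓ `axialLead_of_not_mem` + `uniqueTop_of_not_mem_Eset` + `shiftedAxialTransfer`
+ ✓ `isEdgeDir_mul_left` + ✓ `ostrowski`; the twin of ✓ `Eset_subset_of_axial` of `…RankThreeAffineBinomial`).  FILE B instantiates `N := E₂`, `v := w 1`,
`G := β`, `M := w 0`, `F' := w 0 ^ a`, `Br := S″` (crit-8 #66 (ii)).
HONEST LABEL: helper ENGINE for a side-ladder located instance of the OPEN rung 3-AFF (`…Cruxes.TwoProducts.ValIdea35g10.RankThreeAffineLaw`); NOT γ;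
nothing here closes 5906 / `PlanarCellBound` / `ResidualLawV25`; `TwoProducts` OPEN; 0 summit distance; VP ≠ VNP is NOT proved here or anywhere in this tree.
`--supports stmt-ValiantsHypothesis-5906 --as helper` (val-port-1 g5; critic of record val-idea-crit-8 g4).  No instances, no notation, no named facts. [folklore]
-/

noncomputable section
set_option linter.dupNamespace false

namespace Summit.ValiantsHypothesis.ValiantsHypothesis.Theorems.TwoProducts.RankTwoJacobian

open scoped BigOperators Pointwise
open MvPolynomial

section TowerKernel
open scoped Classical

/-! ### §1 Cells cut by `Xc σ v ∪ Eset σ G`: outside them `G` has a unique top; on a cell `e`, `g` and the shifted-axis top point are constant -/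

/-- Outside its tie values a nonzero `G` has a unique top (the twin of ✓ `axialLead_of_not_mem`). [folklore] -/
theorem uniqueTop_of_not_mem_Eset {σ : ℝ} (hσ : σ = 1 ∨ σ = -1) {G : Poly2} (hG : G ≠ 0) {μ : ℝ}
    (hμ : μ ∉ Eset σ G) : ∃ g, IsUniqueTop (dir σ μ) G g := by
  obtain ⟨g, hg, hmax⟩ := Finset.exists_max_image G.support (wt (dir σ μ)) (support_nonempty' hG)
  refine ⟨g, hg, fun s hs hsg => ?_⟩
  rcases (hmax s hs).lt_or_eq with h | h
  · exact h
  · exfalso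
    apply hμ
    rw [mem_Eset hσ]
    exact ⟨g, hg, s, hs, fun h' => hsg h'.symm, hmax, h⟩

/-- the cell-cutting set: exceptional values of the carrier `v` and tie values of the multiplier `G` -/
def XcU (σ : ℝ) (v G : Poly2) : Finset ℝ := Xc σ v ∪ Eset σ G

/-- cell index relative to `XcU` -/
def idxU (σ : ℝ) (v G : Poly2) (μ : ℝ) : ℕ := ((XcU σ v G).filter (fun z => z < μ)).card

/-- `idxU ≤ |XcU|`. [folklore] -/
theorem idxU_le (σ : ℝ) (v G : Poly2) (μ : ℝ) : idxU σ v G μ ≤ (XcU σ v G).card := Finset.card_filter_le _ _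

/-- Equal cell indices ⇒ no point of `XcU` in between. [folklore] -/
theorem gapU_of_idx_eq {σ : ℝ} {v G : Poly2} {x y : ℝ} (_hxy : x < y) (h : idxU σ v G x = idxU σ v G y) :
    ∀ z ∈ XcU σ v G, ¬ (x < z ∧ z < y) := by
  rintro z hz ⟨hxz, hzy⟩
  have hsub : (XcU σ v G).filter (fun z => z < x) ⊂ (XcU σ v G).filter (fun z => z < y) := by
    rw [Finset.ssubset_iff_of_subset]
    · exact ⟨z, Finset.mem_filter.mpr ⟨hz, hzy⟩, fun h => by
        have := (Finset.mem_filter.mp h).2; linarith⟩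
    · intro u hu
      obtain ⟨hu1, hu2⟩ := Finset.mem_filter.mp hu
      exact Finset.mem_filter.mpr ⟨hu1, by linarith⟩
  have := Finset.card_lt_card hsub
  unfold idxU at h
  omega

/-- On a gap of the tie values of `G` the unique top of `G` is constant (✓ `exists_tie_between`). [folklore] -/
theorem uniqueTop_eq_of_gap {σ : ℝ} (hσ : σ = 1 ∨ σ = -1) {G : Poly2} {x y : ℝ} (hxy : x < y)
    (hgap : ∀ z ∈ Eset σ G, ¬ (x < z ∧ z < y)) {g g' : Expo} (hg : IsUniqueTop (dir σ x) G g)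
    (hg' : IsUniqueTop (dir σ y) G g') : g = g' := by
  by_contra hne
  obtain ⟨μ, h1, h2, htie⟩ := exists_tie_between hσ G.support hxy ⟨hg.1, hg.2⟩ ⟨hg'.1, hg'.2⟩ hne
  exact hgap μ ((mem_Eset hσ).mpr htie) ⟨h1, h2⟩

/-- Real bookkeeping behind `shiftPoint_eq`: `δ·Wx = ε·Dx ≥ 0`, `δ·Wy = ε·Dy ≤ 0` with `Wx, Wy` nonzero of the same sign force `δ = 0`. [folklore] -/
theorem eq_zero_of_sameSign {δ ε Wx Wy Dx Dy : ℝ} (hε : 0 ≤ ε) (hWx : Wx ≠ 0) (hWy : Wy ≠ 0)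
    (hs : 0 < Wx ↔ 0 < Wy) (hDx : 0 ≤ Dx) (hDy : Dy ≤ 0) (h1 : δ * Wx = ε * Dx) (h2 : δ * Wy = ε * Dy) :
    δ = 0 := by
  have hp : 0 ≤ ε * Dx := mul_nonneg hε hDx
  have hn : ε * Dy ≤ 0 := mul_nonpos_of_nonneg_of_nonpos hε hDy
  rcases lt_or_gt_of_ne hWx with hneg | hpos
  · have hWy' : Wy < 0 := by
      rcases lt_or_gt_of_ne hWy with h | h
      · exact h
      · exact absurd (hs.mpr h) (not_lt.mpr hneg.le)
    have k1 : δ ≤ 0 := by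
      by_contra hk; push Not at hk
      have : δ * Wx < 0 := mul_neg_of_pos_of_neg hk hneg
      linarith
    have k2 : 0 ≤ δ := by
      by_contra hk; push Not at hk
      have : 0 < δ * Wy := mul_pos_of_neg_of_neg hk hWy'
      linarith
    linarith
  · have hWy' : 0 < Wy := hs.mp hpos
    have k1 : 0 ≤ δ := by
      by_contra hk; push Not at hk
      have : δ * Wx < 0 := mul_neg_of_neg_of_pos hk hpos
      linarith
    have k2 : δ ≤ 0 := by
      by_contra hk; push Not at hk
      have : 0 < δ * Wy := mul_pos hk hWy'
      linarith
    linarith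

/-- On one cell, all shift-specials share their shifted-axis top point: two facing top points of `Newt F` on `g + ℝ·e` differ by a real
multiple of `e`, and `⟨dir σ ·, e⟩` keeps its sign on the cell (✓ `sameSign`). [folklore] -/
theorem shiftPoint_eq {σ : ℝ} {v F : Poly2} {x y : ℝ} (hxy : x < y)
    (hgap : ∀ z ∈ Xc σ v, ¬ (x < z ∧ z < y)) {e g : Expo} (hex : IsAxialLead (dir σ x) v e)
    (hey : IsAxialLead (dir σ y) v e) {a a' : Expo} (ha : OnLineShift a g e) (ha' : OnLineShift a' g e)
    (haS : a ∈ F.support) (ha'S : a' ∈ F.support)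
    (hatop : ∀ r ∈ F.support, wt (dir σ x) r ≤ wt (dir σ x) a)
    (ha'top : ∀ r ∈ F.support, wt (dir σ y) r ≤ wt (dir σ y) a') : a = a' := by
  obtain ⟨heS, he0, hWx, -⟩ := hex
  obtain ⟨-, -, hWy, -⟩ := hey
  have heS1 : e ∈ S1 v := mem_S1.mpr ⟨heS, he0⟩
  have hsign := sameSign hxy hgap heS1 hWx hWy
  -- det(a − a', e) = 0 in ℝ
  unfold OnLineShift at ha ha'
  have h12 : ((idet a e : ℤ) : ℝ) = ((idet a' e : ℤ) : ℝ) := by rw [ha, ha']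
  simp only [idet, Int.cast_sub, Int.cast_mul, Int.cast_natCast] at h12
  have hDx : 0 ≤ wt (dir σ x) a - wt (dir σ x) a' := sub_nonneg.mpr (hatop a' ha'S)
  have hDy : wt (dir σ y) a - wt (dir σ y) a' ≤ 0 := sub_nonpos.mpr (ha'top a haS)
  -- coordinate identities `e_i·(wt a − wt a') = (a_i − a'_i)·wt e`
  have I0 : ∀ l : ℝ, (((a 0 : ℕ) : ℝ) - ((a' 0 : ℕ) : ℝ)) * wt (dir σ l) e =
      ((e 0 : ℕ) : ℝ) * (wt (dir σ l) a - wt (dir σ l) a') := by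
    intro l
    rw [wt_dir, wt_dir, wt_dir]
    linear_combination σ * h12
  have I1 : ∀ l : ℝ, (((a 1 : ℕ) : ℝ) - ((a' 1 : ℕ) : ℝ)) * wt (dir σ l) e =
      ((e 1 : ℕ) : ℝ) * (wt (dir σ l) a - wt (dir σ l) a') := by
    intro l
    rw [wt_dir, wt_dir, wt_dir]
    linear_combination (-l) * h12
  have c0 : ((a 0 : ℕ) : ℝ) - ((a' 0 : ℕ) : ℝ) = 0 :=
    eq_zero_of_sameSign (Nat.cast_nonneg (e 0)) hWx hWy hsign hDx hDy (I0 x) (I0 y)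
  have c1 : ((a 1 : ℕ) : ℝ) - ((a' 1 : ℕ) : ℝ) = 0 :=
    eq_zero_of_sameSign (Nat.cast_nonneg (e 1)) hWx hWy hsign hDx hDy (I1 x) (I1 y)
  have h0 : a 0 = a' 0 := by
    have : ((a 0 : ℕ) : ℝ) = ((a' 0 : ℕ) : ℝ) := by linarith
    exact_mod_cast this
  have h1 : a 1 = a' 1 := by
    have : ((a 1 : ℕ) : ℝ) = ((a' 1 : ℕ) : ℝ) := by linarith
    exact_mod_cast this
  exact expo_eq_of_coords h0 h1

/-! ### §2 The shift-special set `SpecShift` and its count -/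

/-- the SHIFT-SPECIAL chart values of `F` relative to the carrier `v` and the multiplier `G` (outside `Xc σ v` and the tie values of `G`) -/
def SpecShift (σ : ℝ) (v G F : Poly2) : Finset ℝ :=
  (EV σ F).filter (fun μ => μ ∉ Xc σ v ∧ μ ∉ Eset σ G ∧
    ∃ e g, IsAxialLead (dir σ μ) v e ∧ IsUniqueTop (dir σ μ) G g ∧ IsSpecialShift (dir σ μ) F e g)

/-- at most two shift-specials per cell -/
theorem specShift_fibre_le_two {σ : ℝ} (hσ : σ = 1 ∨ σ = -1) (v G F : Poly2) (b : ℕ) :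
    ((SpecShift σ v G F).filter (fun μ => idxU σ v G μ = b)).card ≤ 2 := by
  by_contra h3; push Not at h3
  set f := (SpecShift σ v G F).filter (fun μ => idxU σ v G μ = b) with hf
  have hne : f.Nonempty := Finset.card_pos.mp (by omega)
  set x := f.min' hne with hx
  set y := f.max' hne with hy
  have hxf : x ∈ f := Finset.min'_mem f hne
  have hyf : y ∈ f := Finset.max'_mem f hne
  have hcard : ((f.erase x).erase y).card ≥ 1 := by
    have h1 := Finset.card_erase_of_mem hxf
    have h2 : ((f.erase x).erase y).card ≥ (f.erase x).card - 1 := by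
      by_cases hy' : y ∈ f.erase x
      · rw [Finset.card_erase_of_mem hy']
      · rw [Finset.erase_eq_of_notMem hy']; omega
    omega
  obtain ⟨m, hm⟩ := Finset.card_pos.mp (by omega : 0 < ((f.erase x).erase y).card)
  have hmy : m ≠ y := Finset.ne_of_mem_erase hm
  have hm' := Finset.mem_of_mem_erase hm
  have hmx : m ≠ x := Finset.ne_of_mem_erase hm'
  have hmf : m ∈ f := Finset.mem_of_mem_erase hm'
  have hxm : x < m := lt_of_le_of_ne (Finset.min'_le f m hmf) (Ne.symm hmx)
  have hmy' : m < y := lt_of_le_of_ne (Finset.le_max' f m hmf) hmy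
  -- unpack the three shift-specials
  have unpack : ∀ u ∈ f, idxU σ v G u = b ∧ u ∉ Xc σ v ∧ u ∉ Eset σ G ∧
      ∃ e g, IsAxialLead (dir σ u) v e ∧ IsUniqueTop (dir σ u) G g ∧ IsSpecialShift (dir σ u) F e g := by
    intro u hu
    obtain ⟨hu1, hu2⟩ := Finset.mem_filter.mp hu
    obtain ⟨-, hu3, hu4, hu5⟩ := Finset.mem_filter.mp hu1
    exact ⟨hu2, hu3, hu4, hu5⟩
  obtain ⟨ix, -, -, ex, gx, hlx, hux, hsx⟩ := unpack x hxf
  obtain ⟨im, -, -, em, gm, hlm, hum, hsm⟩ := unpack m hmf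
  obtain ⟨iy, -, -, ey, gy, hly, huy, hsy⟩ := unpack y hyf
  have gapU_xm := gapU_of_idx_eq hxm (ix.trans im.symm)
  have gapU_my := gapU_of_idx_eq hmy' (im.trans iy.symm)
  have gap_xm : ∀ z ∈ Xc σ v, ¬ (x < z ∧ z < m) := fun z hz => gapU_xm z (Finset.mem_union_left _ hz)
  have gap_my : ∀ z ∈ Xc σ v, ¬ (m < z ∧ z < y) := fun z hz => gapU_my z (Finset.mem_union_left _ hz)
  have gapG_xm : ∀ z ∈ Eset σ G, ¬ (x < z ∧ z < m) := fun z hz => gapU_xm z (Finset.mem_union_right _ hz)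
  have gapG_my : ∀ z ∈ Eset σ G, ¬ (m < z ∧ z < y) := fun z hz => gapU_my z (Finset.mem_union_right _ hz)
  have exm : ex = em := lead_eq_of_gap hσ hxm gap_xm (lead_utop hlx) (lead_utop hlm)
  have emy : em = ey := lead_eq_of_gap hσ hmy' gap_my (lead_utop hlm) (lead_utop hly)
  subst exm; subst emy
  have gxm : gx = gm := uniqueTop_eq_of_gap hσ hxm gapG_xm hux hum
  have gmy : gm = gy := uniqueTop_eq_of_gap hσ hmy' gapG_my hum huy
  subst gxm; subst gmy
  obtain ⟨ax, haxS, hax, htx⟩ := specialShift_line_top hsx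
  obtain ⟨am, hamS, ham, htm⟩ := specialShift_line_top hsm
  obtain ⟨ay, hayS, hay, hty⟩ := specialShift_line_top hsy
  have e1 : ax = am := shiftPoint_eq hxm gap_xm hlx hlm hax ham haxS hamS htx htm
  have e2 : am = ay := shiftPoint_eq hmy' gap_my hlm hly ham hay hamS hayS htm hty
  subst e1; subst e2
  have hu := utop_between hσ hxm hmy' haxS htx hty
  exact not_tie_of_utop hu (specialShift_tie hsm)

/-- ★ **The shift-special set has `≤ 2·(|Xc σ v ∪ Eset σ G| + 1)` elements.** -/
theorem card_SpecShift_le {σ : ℝ} (hσ : σ = 1 ∨ σ = -1) (v G F : Poly2) :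
    (SpecShift σ v G F).card ≤ 2 * ((Xc σ v ∪ Eset σ G).card + 1) := by
  have h1 : (SpecShift σ v G F).card ≤ 2 * ((SpecShift σ v G F).image (idxU σ v G)).card :=
    Finset.card_le_mul_card_image _ 2 (fun b _ => specShift_fibre_le_two hσ v G F b)
  have h2 : ((SpecShift σ v G F).image (idxU σ v G)).card ≤ (XcU σ v G).card + 1 := by
    have hsub : (SpecShift σ v G F).image (idxU σ v G) ⊆ Finset.range ((XcU σ v G).card + 1) := by
      intro b hb
      obtain ⟨μ, -, rfl⟩ := Finset.mem_image.mp hb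
      exact Finset.mem_range.mpr (Nat.lt_succ_of_le (idxU_le σ v G μ))
    exact (Finset.card_le_card hsub).trans (by simp)
  calc (SpecShift σ v G F).card ≤ 2 * ((SpecShift σ v G F).image (idxU σ v G)).card := h1
    _ ≤ 2 * ((XcU σ v G).card + 1) := Nat.mul_le_mul_left 2 h2
    _ = 2 * ((Xc σ v ∪ Eset σ G).card + 1) := rfl

/-- The same count in the additive form `≤ 2·(|Xc σ v| + |Eset σ G| + 1)` (then ✓ `card_Xc_le`, ✓ `card_Eset_le` make it `poly(t)`). [folklore] -/
theorem card_SpecShift_le' {σ : ℝ} (hσ : σ = 1 ∨ σ = -1) (v G F : Poly2) :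
    (SpecShift σ v G F).card ≤ 2 * ((Xc σ v).card + (Eset σ G).card + 1) :=
  (card_SpecShift_le hσ v G F).trans
    (Nat.mul_le_mul_left 2 (Nat.add_le_add_right (Finset.card_union_le _ _) 1))

/-! ### §3 The one-call template for the client (FILE B) -/

/-- ★ **ONE-STEP SHIFTED TEMPLATE.** If `v` is a non-constant carrier, `G ≠ 0`, `M ≠ 0` and `M·(G·J(N,v) − N·J(G,v)) = F'·Br`, then every edge
direction of `N` in the chart `σ` is an exceptional value of `v`, a tie value of `G`, a shift-special value, or an edge direction of `F'` or of `Br`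
(✓ `axialLead_of_not_mem` + `uniqueTop_of_not_mem_Eset` + `shiftedAxialTransfer` + ✓ `isEdgeDir_mul_left` + ✓ `ostrowski`). -/
theorem Eset_subset_of_shifted {σ : ℝ} (hσ : σ = 1 ∨ σ = -1) {v G M N F' Br : Poly2} (hv : (S1 v).Nonempty)
    (hG : G ≠ 0) (hM : M ≠ 0) (hid : M * (G * jac N v - N * jac G v) = F' * Br) :
    Eset σ N ⊆ Xc σ v ∪ Eset σ G ∪ SpecShift σ v G N ∪ (Eset σ F' ∪ Eset σ Br) := by
  intro μ hμ
  have hedge := (mem_Eset hσ).mp hμ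
  by_cases hX : μ ∈ Xc σ v
  · exact Finset.mem_union_left _ (Finset.mem_union_left _ (Finset.mem_union_left _ hX))
  by_cases hE : μ ∈ Eset σ G
  · exact Finset.mem_union_left _ (Finset.mem_union_left _ (Finset.mem_union_right _ hE))
  obtain ⟨e, hlead⟩ := axialLead_of_not_mem hσ hv hX
  obtain ⟨g, hg⟩ := uniqueTop_of_not_mem_Eset hσ hG hE
  rcases shiftedAxialTransfer (dir σ μ) N G v e g (ne_zero_of_isEdgeDir hedge) hlead hg hedge with hsp | hW
  · apply Finset.mem_union_left; apply Finset.mem_union_right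
    unfold SpecShift
    exact Finset.mem_filter.mpr ⟨mem_EV_of_tie hσ hedge, hX, hE, e, g, hlead, hg, hsp⟩
  · have hMW : IsEdgeDir (dir σ μ) ((G * jac N v - N * jac G v) * M) := isEdgeDir_mul_left _ _ _ hM hW
    rw [mul_comm, hid] at hMW
    have hF' : F' ≠ 0 := fun h => ne_zero_of_isEdgeDir hMW (by rw [h, zero_mul])
    have hBr : Br ≠ 0 := fun h => ne_zero_of_isEdgeDir hMW (by rw [h, mul_zero])
    apply Finset.mem_union_right
    rcases (ostrowski _ F' Br hF' hBr).mp hMW with h | h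
    · exact Finset.mem_union_left _ ((mem_Eset hσ).mpr h)
    · exact Finset.mem_union_right _ ((mem_Eset hσ).mpr h)

/-- The template packaged in the `∃ SS`-shape FILE B types against (val-port-4 g4's hypothesis `ShiftedAxialBound`, bus 2026-08-29T07:11:03Z, is this statement
quantified over `σ = ±1` and all `v G N M F' Br` — discharged by `fun σ hσ v G N M F' Br => exists_shiftSpecial_bound hσ`). [folklore] -/
theorem exists_shiftSpecial_bound {σ : ℝ} (hσ : σ = 1 ∨ σ = -1) {v G N M F' Br : Poly2} (hv : (S1 v).Nonempty)
    (hG : G ≠ 0) (hM : M ≠ 0) (hid : M * (G * jac N v - N * jac G v) = F' * Br) :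
    ∃ SS : Finset ℝ, SS.card ≤ 2 * ((Xc σ v).card + (Eset σ G).card + 1) ∧
      Eset σ N ⊆ Xc σ v ∪ Eset σ G ∪ SS ∪ (Eset σ F' ∪ Eset σ Br) :=
  ⟨SpecShift σ v G N, card_SpecShift_le' hσ v G N, Eset_subset_of_shifted hσ hv hG hM hid⟩

end TowerKernel

end Summit.ValiantsHypothesis.ValiantsHypothesis.Theorems.TwoProducts.RankTwoJacobian

end
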